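import Summits.Ventures.QEC.Census.CertCoverBatch
import Summits.Ventures.QEC.Census.BB.A1s_n192_k8_0aff2053.CoreDefs
import HarnessLib

set_option Elab.async false
set_option maxRecDepth 200000

/-!
# `[[192,8,16]]` one-level cover certificate of `A1s_n192_k8_0aff2053` — LEVEL-1→0 coset problems 125…145 (deep problems [1] excluded: `ProbDeep*.lean`) as COMPACT data
(`ProbData`: U, f, σ, y₀, allow; qec-type-10 `CertCoverBatch.mkCoset` rebuilds each `CosetProb` in the kernel) + their verdict
`probsOK cov covR hx hx1 D1 lxd 14` (one `decide +kernel`; 21 problems, depths f=0:20 f=1:1 f=2:0 f=3:0, est. 78.0 s).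
qec-search-1 g5 (pattern of search-9 g5 `Probs*`); data from JSON `level10.problems` (sha256 468320419c3ce562…). Data + decided check; KERNEL.
-/

namespace Summit.Ventures.QEC.Census.A1s_n192_k8_0aff2053

open Matrix Summit.Ventures.QEC.Census Literature.InformationTheory.QuantumCodes

/-- Problems 125…145 (21): `⟨U, f, σ, y₀, allow⟩`. -/
def probs03 : List ProbData := [
    ⟨19368804936557216628080916, 0, 140737857487109, 21269456205117357554132, []⟩,
    ⟨19432888781327569011083288, 0, 140737773572867, 19357035553514896859596800, [0]⟩,
    ⟨19649915671317462418849796, 0, 140737555466257, 302379029071842786410288, []⟩,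
    ⟨19952147127342621606412288, 0, 140737555466257, 19947424750726669946044480, []⟩,
    ⟨19961591869315560117895169, 0, 140737555466257, 19947424750726669946044480, []⟩,
    ⟨20934564251772462133413888, 0, 140737781960980, 20627591947613065116126977, []⟩,
    ⟨22521592964681194759459072, 0, 140737790353920, 2573726644666524164682192, []⟩,
    ⟨22974368288417905412999168, 0, 140737756791576, 19342868454066356651821056, [0]⟩,
    ⟨33864238200338274467708929, 0, 140737555466257, 9671407133377786799980604, []⟩,
    ⟨38709318476920430719402016, 0, 140738025227332, 18969018078259451003280, []⟩,
    ⟨38711617978333691549712404, 0, 140738125922564, 38687987410909661359242950, []⟩,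
    ⟨39011549067132958488395776, 1, 140738025227332, 18969018078259451003280, []⟩,
    ⟨39031619124720613726355456, 0, 140738125907016, 1152956733010869280, []⟩,
    ⟨39313779657345490535579744, 0, 140738025227332, 18889466494700618784400, []⟩,
    ⟨39616011400479522911420480, 0, 140738025227332, 623431351424823874027984, []⟩,
    ⟨40213330267652770520895488, 0, 140738042036483, 39899292860513004878303728, []⟩,
    ⟨41864406150572853461979136, 0, 140738058789377, 39290679505906372469383632, []⟩,
    ⟨42015521877463931161874434, 0, 140738058789377, 39592357575939288593592418, []⟩,
    ⟨77980660835448668763004928, 0, 140738562100248, 604464639189573645107200, [0]⟩,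
    ⟨96796719682912825704448000, 0, 140738696347825, 696256504, []⟩,
    ⟨193584289780773818860568576, 0, 140740197880160, 295148195451816120305, []⟩]

set_option maxHeartbeats 400000000 in
/-- Every problem of this chunk passes (`mkCoset` elimination + `cosetOKD` + fast `σ` + depth + `BU`-evenness + label checks). -/
theorem probs03_ok : probsOK A1s_n192_k8_0aff2053.cov covR hx hx1 D1 lxd 14 probs03 = true := by
  decide +kernel

/-- Pointwise form. -/
theorem probs03_all : ∀ x ∈ A1s_n192_k8_0aff2053.probs03, probOK cov covR hx hx1 D1 lxd 14 x = true := by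
  have h := probs03_ok
  rwa [probsOK, List.all_eq_true] at h

end Summit.Ventures.QEC.Census.A1s_n192_k8_0aff2053
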